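import Mathlib
import HarnessLib

/-!
# Coarse skeleton paths along a compact connected planar set

Pure metric geometry in `ℂ`.  For a compact preconnected `Γ ⊆ ℂ`, a point `a ∈ Γ`, a mesh
`ε > 0` and an integer `M ≥ 3`, there is a chain `p 0, …, p k` of points of the grid
`ε ℤ² ⊆ ℂ`, each within `ε` of `Γ`, pairwise `(M - 1) ε`-separated, consecutively
`(M + 1) ε`-close, starting within `(M + 1) ε` of `a`, and long enough that
`diam Γ ≤ 2 (k + 3) (M + 1) ε`.

Proof.  Among finite families `S` of grid points within `ε` of `Γ` which are
`(M - 1) ε`-separated, contain a fixed grid point `r` within `ε` of `a`, and are connected for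
the *shell relation* `(M - 1) ε ≤ dist p q ≤ (M + 1) ε` on `S`, pick one of maximal cardinality
(they all live in a fixed finite box).  Maximality and the intermediate value theorem applied to
`w ↦ infDist w S` on the preconnected set `Γ` show that `Γ` is covered by the closed
`(M + 1) ε`-balls around `S`.  A simple path in the shell graph from `r` to a point of `S` near a
far point `b ∈ Γ` is the required skeleton.

No definitions are introduced: the shell relation is always written out as
`fun p q ↦ p ∈ S ∧ q ∈ S ∧ (M - 1) ε ≤ dist p q ∧ dist p q ≤ (M + 1) ε`.
-/

noncomputable section

namespace Summit.CriticalPhenomena.CardyFormulaZ2.Cruxes.MagicFormulaT.LineSketch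

open Metric Set

variable {Γ : Set ℂ} {a : ℂ} {ε : ℝ} {M : ℕ} {S : Finset ℂ}

/-! ### Grid rounding -/

/-- One real coordinate of the rounding error is at most `ε / 2`. -/
theorem abs_mul_round_div_sub_le (hε : 0 < ε) (t : ℝ) :
    |ε * (round (t / ε) : ℝ) - t| ≤ ε / 2 := by
  have h1 := abs_le.mp (abs_sub_round (t / ε))
  have h2 : t / ε * ε = t := div_mul_cancel₀ t hε.ne'
  have h3 : -(1 / 2) * ε ≤ (t / ε - round (t / ε)) * ε :=
    mul_le_mul_of_nonneg_right h1.1 hε.le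
  have h4 : (t / ε - round (t / ε)) * ε ≤ 1 / 2 * ε :=
    mul_le_mul_of_nonneg_right h1.2 hε.le
  rw [sub_mul, h2] at h3 h4
  rw [abs_le]
  constructor <;> linarith

/-- Every point of `ℂ` is within `ε` of a point of the grid `ε ℤ²` (coordinatewise rounding). -/
theorem exists_grid_near (hε : 0 < ε) (z : ℂ) :
    ∃ q : ℂ, (∃ x y : ℤ, q = ε * (x + y * Complex.I)) ∧ dist q z ≤ ε := by
  refine ⟨ε * (round (z.re / ε) + round (z.im / ε) * Complex.I), ⟨_, _, rfl⟩, ?_⟩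
  rw [dist_eq_norm]
  refine (Complex.norm_le_abs_re_add_abs_im _).trans ?_
  have hre : ((ε : ℂ) * (round (z.re / ε) + round (z.im / ε) * Complex.I) - z).re
      = ε * (round (z.re / ε) : ℝ) - z.re := by
    simp
  have him : ((ε : ℂ) * (round (z.re / ε) + round (z.im / ε) * Complex.I) - z).im
      = ε * (round (z.im / ε) : ℝ) - z.im := by
    simp
  rw [hre, him]
  have h1 := abs_mul_round_div_sub_le hε z.re
  have h2 := abs_mul_round_div_sub_le hε z.im
  linarith

/-- A finite box of grid points containing every grid point within `ε` of the nonempty compact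
set `Γ`. -/
theorem exists_grid_box (hΓ : IsCompact Γ) (hne : Γ.Nonempty) (hε : 0 < ε) :
    ∃ U : Finset ℂ, (∀ p ∈ U, ∃ x y : ℤ, p = ε * (x + y * Complex.I)) ∧
      ∀ q : ℂ, (∃ x y : ℤ, q = ε * (x + y * Complex.I)) → infDist q Γ ≤ ε → q ∈ U := by
  obtain ⟨R, hR⟩ := isBounded_iff_forall_norm_le.mp hΓ.isBounded
  refine ⟨Finset.image (fun xy : ℤ × ℤ ↦ (ε : ℂ) * ((xy.1 : ℂ) + (xy.2 : ℂ) * Complex.I))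
    (Finset.Icc (-⌈(R + ε) / ε⌉) ⌈(R + ε) / ε⌉ ×ˢ Finset.Icc (-⌈(R + ε) / ε⌉) ⌈(R + ε) / ε⌉),
    ?_, ?_⟩
  · intro p hp
    obtain ⟨⟨x, y⟩, -, rfl⟩ := Finset.mem_image.mp hp
    exact ⟨x, y, rfl⟩
  · rintro q ⟨x, y, rfl⟩ hq
    obtain ⟨γ, hγ, hdist⟩ := hΓ.exists_infDist_eq_dist hne ((ε : ℂ) * (x + y * Complex.I))
    have hnorm : ‖(ε : ℂ) * (x + y * Complex.I)‖ ≤ R + ε := by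
      have h1 := dist_triangle ((ε : ℂ) * (x + y * Complex.I)) γ 0
      simp only [dist_zero_right] at h1
      have h2 := hR γ hγ
      linarith
    have key : ∀ n : ℤ, |ε * (n : ℝ)| ≤ R + ε →
        n ∈ Finset.Icc (-⌈(R + ε) / ε⌉) ⌈(R + ε) / ε⌉ := by
      intro n hn
      rw [abs_mul, abs_of_pos hε] at hn
      have h1 : |(n : ℝ)| ≤ (R + ε) / ε := by
        rw [le_div_iff₀ hε]
        linarith
      have h2 := abs_le.mp h1
      have h3 : ((R + ε) / ε : ℝ) ≤ ⌈(R + ε) / ε⌉ := Int.le_ceil _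
      rw [Finset.mem_Icc]
      constructor
      · have : ((-⌈(R + ε) / ε⌉ : ℤ) : ℝ) ≤ n := by
          push_cast
          linarith
        exact_mod_cast this
      · have : (n : ℝ) ≤ ((⌈(R + ε) / ε⌉ : ℤ) : ℝ) := by linarith
        exact_mod_cast this
    refine Finset.mem_image.mpr ⟨(x, y), ?_, rfl⟩
    rw [Finset.mem_product]
    refine ⟨key x ?_, key y ?_⟩
    · have h := (Complex.abs_re_le_norm _).trans hnorm
      simpa using h
    · have h := (Complex.abs_im_le_norm _).trans hnorm
      simpa using h

/-! ### Chains from walks -/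

/-- In a graph all of whose edges end in `S`, a walk starting in `S` stays in `S`. -/
theorem getVert_mem_of_adj {V : Type*} {G : SimpleGraph V} {S : Finset V}
    (hG : ∀ p q, G.Adj p q → q ∈ S) {u v : V} (W : G.Walk u v) (hu : u ∈ S) (i : ℕ) :
    W.getVert i ∈ S := by
  induction W generalizing i with
  | nil => simpa using hu
  | cons h W ih =>
    cases i with
    | zero => simpa using hu
    | succ n =>
      rw [SimpleGraph.Walk.getVert_cons_succ]
      exact ih (hG _ _ h) n

/-- In a graph whose edges have length at most `C`, the `i`-th vertex of a walk is within `i C`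
of its start. -/
theorem dist_getVert_le_of_adj {V : Type*} [PseudoMetricSpace V] {G : SimpleGraph V} {C : ℝ}
    (hG : ∀ p q, G.Adj p q → dist p q ≤ C) {u v : V} (W : G.Walk u v) :
    ∀ i, i ≤ W.length → dist u (W.getVert i) ≤ i * C := by
  intro i
  induction i with
  | zero =>
    intro
    simp
  | succ n ih =>
    intro hn
    have h1 := ih (Nat.le_of_succ_le hn)
    have h2 := hG _ _ (W.adj_getVert_succ (Nat.lt_of_succ_le hn))
    push_cast
    calc dist u (W.getVert (n + 1))
        ≤ dist u (W.getVert n) + dist (W.getVert n) (W.getVert (n + 1)) := dist_triangle _ _ _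
      _ ≤ n * C + C := add_le_add h1 h2
      _ = ((n : ℝ) + 1) * C := by ring

/-- Chain extraction.  If `b` is reachable from `r ∈ S` through a relation `R` supported on `S`
whose steps have length at most `C`, then there is a duplicate-free chain `p 0 = r, …, p k` in
`S` with consecutive points at distance at most `C` and `dist r b ≤ k C` (a simple path in the
graph generated by `R`). -/
theorem exists_chain_of_reflTransGen {V : Type*} [PseudoMetricSpace V] {R : V → V → Prop}
    {S : Finset V} {C : ℝ} (hR : ∀ p q, R p q → p ∈ S ∧ q ∈ S ∧ dist p q ≤ C) {r b : V}
    (hr : r ∈ S) (h : Relation.ReflTransGen R r b) :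
    ∃ (k : ℕ) (p : Fin (k + 1) → V), (∀ i, p i ∈ S) ∧ p 0 = r ∧ (∀ i j, i ≠ j → p i ≠ p j) ∧
      (∀ i : Fin k, dist (p i.castSucc) (p i.succ) ≤ C) ∧ dist r b ≤ k * C := by
  have hG : ∀ p q, (SimpleGraph.fromRel R).Adj p q → p ∈ S ∧ q ∈ S ∧ dist p q ≤ C := by
    intro p q hpq
    rw [SimpleGraph.fromRel_adj] at hpq
    rcases hpq.2 with h' | h'
    · exact hR p q h'
    · obtain ⟨h1, h2, h3⟩ := hR q p h'
      exact ⟨h2, h1, by rwa [dist_comm]⟩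
  have hreach : (SimpleGraph.fromRel R).Reachable r b := by
    induction h with
    | refl => exact SimpleGraph.Reachable.refl _
    | @tail b' c _ hbc ih =>
      by_cases hne : b' = c
      · subst hne
        exact ih
      · exact ih.trans
          (SimpleGraph.Adj.reachable ((SimpleGraph.fromRel_adj _ _ _).mpr ⟨hne, Or.inl hbc⟩))
  obtain ⟨W, hW⟩ := hreach.exists_isPath
  refine ⟨W.length, fun i ↦ W.getVert i,
    fun i ↦ getVert_mem_of_adj (fun p q hpq ↦ (hG p q hpq).2.1) W hr i, by simp, ?_, ?_, ?_⟩
  · intro i j hij heq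
    apply hij
    exact Fin.ext (hW.getVert_injOn (by simpa using Nat.lt_succ_iff.mp i.2)
      (by simpa using Nat.lt_succ_iff.mp j.2) heq)
  · intro i
    have := (hG _ _ (W.adj_getVert_succ (i := i) i.2)).2.2
    simpa using this
  · have := dist_getVert_le_of_adj (fun p q hpq ↦ (hG p q hpq).2.2) W W.length le_rfl
    rwa [W.getVert_length] at this

/-! ### The extension step -/

/-- Extension step.  Let `S` be a skeleton family: it contains a point `r` within `ε` of
`a ∈ Γ`, is `(M - 1) ε`-separated, and every point of `S` is reachable from `r` through the
shell relation `(M - 1) ε ≤ dist p q ≤ (M + 1) ε` on `S`.  If some point of `Γ` is farther than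
`(M + 1) ε` from `S`, then `S` can be enlarged by one grid point within `ε` of `Γ` keeping
separation and shell-connectedness.  The new point is the rounding of a point `w ∈ Γ` with
`infDist w S = M ε`, found by the intermediate value theorem on the preconnected set `Γ`. -/
theorem exists_cons_skeleton (hΓ : IsPreconnected Γ) (ha : a ∈ Γ) (hε : 0 < ε) (hM : 3 ≤ M)
    {r : ℂ} (hrS : r ∈ S) (hra : dist r a ≤ ε)
    (hsep : ∀ p ∈ S, ∀ q ∈ S, p ≠ q → ((M : ℝ) - 1) * ε ≤ dist p q)
    (hconn : ∀ p ∈ S, Relation.ReflTransGen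
      (fun p q ↦ p ∈ S ∧ q ∈ S ∧ ((M : ℝ) - 1) * ε ≤ dist p q ∧ dist p q ≤ ((M : ℝ) + 1) * ε)
      r p)
    {z : ℂ} (hz : z ∈ Γ) (hfar : ((M : ℝ) + 1) * ε < infDist z (S : Set ℂ)) :
    ∃ q : ℂ, ∃ hq : q ∉ S, (∃ x y : ℤ, q = ε * (x + y * Complex.I)) ∧ infDist q Γ ≤ ε ∧
      (∀ p ∈ Finset.cons q S hq, ∀ p' ∈ Finset.cons q S hq, p ≠ p' →
        ((M : ℝ) - 1) * ε ≤ dist p p') ∧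
      (∀ p ∈ Finset.cons q S hq, Relation.ReflTransGen
        (fun p p' ↦ p ∈ Finset.cons q S hq ∧ p' ∈ Finset.cons q S hq ∧
          ((M : ℝ) - 1) * ε ≤ dist p p' ∧ dist p p' ≤ ((M : ℝ) + 1) * ε)
        r p) := by
  have hM3 : (3 : ℝ) ≤ M := by exact_mod_cast hM
  have hSne : (S : Set ℂ).Nonempty := ⟨_, hrS⟩
  have hφc : Continuous fun w : ℂ ↦ infDist w (S : Set ℂ) := continuous_infDist_pt _
  have hφa : infDist a (S : Set ℂ) ≤ (M : ℝ) * ε := by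
    calc infDist a (S : Set ℂ) ≤ dist a r := infDist_le_dist_of_mem hrS
      _ ≤ ε := by rw [dist_comm]; exact hra
      _ ≤ (M : ℝ) * ε := by nlinarith
  have hφz : (M : ℝ) * ε ≤ infDist z (S : Set ℂ) := by
    have : (M : ℝ) * ε ≤ ((M : ℝ) + 1) * ε := by linarith
    exact this.trans hfar.le
  obtain ⟨w, hw, hφw⟩ : (M : ℝ) * ε ∈ (fun w : ℂ ↦ infDist w (S : Set ℂ)) '' Γ :=
    hΓ.intermediate_value ha hz hφc.continuousOn ⟨hφa, hφz⟩
  simp only at hφw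
  obtain ⟨p₀, hp₀S, hp₀⟩ := (S.finite_toSet.isCompact).exists_infDist_eq_dist hSne w
  rw [Finset.mem_coe] at hp₀S
  obtain ⟨q, hqgrid, hqw⟩ := exists_grid_near hε w
  have hlow : ∀ p ∈ S, ((M : ℝ) - 1) * ε ≤ dist q p := by
    intro p hp
    have h1 : infDist w (S : Set ℂ) ≤ dist w p := infDist_le_dist_of_mem (Finset.mem_coe.mpr hp)
    have h2 : dist w p ≤ dist w q + dist q p := dist_triangle _ _ _
    rw [dist_comm w q] at h2
    linarith
  have hqS : q ∉ S := by
    intro hqS'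
    have := hlow _ hqS'
    rw [dist_self] at this
    nlinarith
  have hup : dist q p₀ ≤ ((M : ℝ) + 1) * ε := by
    have := dist_triangle q w p₀
    linarith
  refine ⟨q, hqS, hqgrid, (infDist_le_dist_of_mem hw).trans hqw, ?_, ?_⟩
  · intro p hp p' hp' hne
    rcases Finset.mem_cons.mp hp with h₁ | h₁ <;> rcases Finset.mem_cons.mp hp' with h₂ | h₂
    · exact absurd (h₁.trans h₂.symm) hne
    · rw [h₁]
      exact hlow p' h₂
    · rw [h₂, dist_comm]
      exact hlow p h₁
    · exact hsep p h₁ p' h₂ hne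
  · -- shell-reachability inside `S` lifts to the enlarged family
    have hlift : ∀ p : ℂ, Relation.ReflTransGen
        (fun p p' ↦ p ∈ S ∧ p' ∈ S ∧ ((M : ℝ) - 1) * ε ≤ dist p p' ∧
          dist p p' ≤ ((M : ℝ) + 1) * ε) r p →
        Relation.ReflTransGen
        (fun p p' ↦ p ∈ Finset.cons q S hqS ∧ p' ∈ Finset.cons q S hqS ∧
          ((M : ℝ) - 1) * ε ≤ dist p p' ∧ dist p p' ≤ ((M : ℝ) + 1) * ε) r p := by
      intro p h
      induction h with
      | refl => exact Relation.ReflTransGen.refl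
      | tail _ hbc ih =>
        exact ih.tail ⟨Finset.subset_cons hqS hbc.1, Finset.subset_cons hqS hbc.2.1, hbc.2.2⟩
    intro p hp
    rcases Finset.mem_cons.mp hp with h₁ | h₁
    · rw [h₁]
      refine (hlift p₀ (hconn p₀ hp₀S)).tail ⟨Finset.subset_cons hqS hp₀S,
        Finset.mem_cons_self _ _, ?_, ?_⟩
      · rw [dist_comm]
        exact hlow p₀ hp₀S
      · rw [dist_comm]
        exact hup
    · exact hlift p (hconn p h₁)

/-! ### The skeleton path -/

/-- **Coarse skeleton path.**  For a compact preconnected `Γ ⊆ ℂ`, `a ∈ Γ`, `ε > 0` and `M ≥ 3`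
there are grid points `p 0, …, p k ∈ ε ℤ²`, each within `ε` of `Γ`, with `p 0` within
`(M + 1) ε` of `a`, pairwise `(M - 1) ε`-separated, consecutively `(M + 1) ε`-close, and with
`diam Γ ≤ 2 (k + 3) (M + 1) ε`. -/
theorem ribbon_skeletonPath : ∀ (Γ : Set ℂ) (a : ℂ) (ε : ℝ) (M : ℕ), IsCompact Γ →
    IsPreconnected Γ → a ∈ Γ → 0 < ε → 3 ≤ M → ∃ (k : ℕ) (p : Fin (k + 1) → ℂ),
      (∀ i, ∃ x y : ℤ, p i = ε * (x + y * Complex.I)) ∧ (∀ i, Metric.infDist (p i) Γ ≤ ε) ∧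
      dist (p 0) a ≤ ((M : ℝ) + 1) * ε ∧
      (∀ i j, i ≠ j → ((M : ℝ) - 1) * ε ≤ dist (p i) (p j)) ∧
      (∀ i : Fin k, dist (p i.castSucc) (p i.succ) ≤ ((M : ℝ) + 1) * ε) ∧
      Metric.diam Γ ≤ 2 * ((k : ℝ) + 3) * ((M : ℝ) + 1) * ε := by
  intro Γ a ε M hΓc hΓ ha hε hM
  -- the root: a grid point within `ε` of `a`
  obtain ⟨r, hrgrid, hra⟩ := exists_grid_near hε a
  have hrΓ : infDist r Γ ≤ ε := (infDist_le_dist_of_mem ha).trans hra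
  obtain ⟨U, hUgrid, hUmem⟩ := exists_grid_box hΓc ⟨a, ha⟩ hε
  -- the finite, nonempty family of skeleton families inside the box `U`
  set F : Set (Finset ℂ) := {S | S ⊆ U ∧ r ∈ S ∧ (∀ p ∈ S, infDist p Γ ≤ ε) ∧
    (∀ p ∈ S, ∀ q ∈ S, p ≠ q → ((M : ℝ) - 1) * ε ≤ dist p q) ∧
    (∀ p ∈ S, Relation.ReflTransGen
      (fun p q ↦ p ∈ S ∧ q ∈ S ∧ ((M : ℝ) - 1) * ε ≤ dist p q ∧ dist p q ≤ ((M : ℝ) + 1) * ε)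
      r p)} with hF
  have hFfin : F.Finite :=
    (U.powerset.finite_toSet).subset fun S hS ↦
      Finset.mem_coe.mpr (Finset.mem_powerset.mpr hS.1)
  have hFne : F.Nonempty := by
    refine ⟨{r}, ?_, Finset.mem_singleton_self _, ?_, ?_, ?_⟩
    · intro p hp
      rw [Finset.mem_singleton] at hp
      subst hp
      exact hUmem _ hrgrid hrΓ
    · intro p hp
      rw [Finset.mem_singleton] at hp
      subst hp
      exact hrΓ
    · intro p hp q hq hpq
      rw [Finset.mem_singleton] at hp hq
      exact absurd (hp.trans hq.symm) hpq
    · intro p hp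
      rw [Finset.mem_singleton] at hp
      subst hp
      exact Relation.ReflTransGen.refl
  obtain ⟨S, ⟨hSU, hrS, hnear, hsep, hconn⟩, hmax⟩ := F.exists_max_image Finset.card hFfin hFne
  -- maximality: `Γ` is covered by the closed `(M + 1) ε`-balls around `S`
  have hcover : ∀ z ∈ Γ, infDist z (S : Set ℂ) ≤ ((M : ℝ) + 1) * ε := by
    intro z hz
    by_contra h
    rw [not_le] at h
    obtain ⟨q, hq, hqgrid, hqΓ, hsep', hconn'⟩ :=
      exists_cons_skeleton hΓ ha hε hM hrS hra hsep hconn hz h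
    have h1 : Finset.cons q S hq ∈ F := by
      refine ⟨fun p hp ↦ ?_, Finset.subset_cons hq hrS, fun p hp ↦ ?_, hsep', hconn'⟩
      · rcases Finset.mem_cons.mp hp with h₁ | h₁
        · rw [h₁]
          exact hUmem _ hqgrid hqΓ
        · exact hSU h₁
      · rcases Finset.mem_cons.mp hp with h₁ | h₁
        · rw [h₁]
          exact hqΓ
        · exact hnear p h₁
    have h2 := hmax _ h1
    rw [Finset.card_cons] at h2
    omega
  -- a far point `b ∈ Γ`: `diam Γ ≤ 2 dist a b`
  obtain ⟨b, hb, hbmax⟩ :=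
    hΓc.exists_isMaxOn (f := fun y ↦ dist a y) ⟨a, ha⟩ (by fun_prop)
  have hdiam : diam Γ ≤ 2 * dist a b := by
    refine diam_le_of_forall_dist_le (by positivity) fun x hx y hy ↦ ?_
    have hx' : dist a x ≤ dist a b := isMaxOn_iff.mp hbmax x hx
    have hy' : dist a y ≤ dist a b := isMaxOn_iff.mp hbmax y hy
    calc dist x y ≤ dist x a + dist a y := dist_triangle _ _ _
      _ = dist a x + dist a y := by rw [dist_comm x a]
      _ ≤ 2 * dist a b := by linarith
  -- the skeleton point nearest to `b`, and a simple shell path from the root to it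
  have hSne : (S : Set ℂ).Nonempty := ⟨_, hrS⟩
  obtain ⟨pb, hpbS, hpb⟩ := (S.finite_toSet.isCompact).exists_infDist_eq_dist hSne b
  rw [Finset.mem_coe] at hpbS
  have hbpb : dist b pb ≤ ((M : ℝ) + 1) * ε := hpb ▸ hcover b hb
  obtain ⟨k, p, hpS, hp0, hinj, hcons, hdist⟩ :=
    exists_chain_of_reflTransGen (fun p q hpq ↦ ⟨hpq.1, hpq.2.1, hpq.2.2.2⟩) hrS (hconn pb hpbS)
  have hM0 : (0 : ℝ) ≤ M := Nat.cast_nonneg M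
  refine ⟨k, p, fun i ↦ hUgrid _ (hSU (hpS i)), fun i ↦ hnear _ (hpS i), ?_, ?_, hcons, ?_⟩
  · rw [hp0]
    calc dist r a ≤ ε := hra
      _ ≤ ((M : ℝ) + 1) * ε := by nlinarith
  · intro i j hij
    exact hsep _ (hpS i) _ (hpS j) (hinj i j hij)
  · have h1 : dist a b ≤ dist a r + dist r pb + dist pb b := dist_triangle4 _ _ _ _
    have h2 : dist a r ≤ ε := by
      rw [dist_comm]
      exact hra
    have h3 : dist pb b ≤ ((M : ℝ) + 1) * ε := by
      rw [dist_comm]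
      exact hbpb
    have hk0 : (0 : ℝ) ≤ k := Nat.cast_nonneg k
    nlinarith [mul_nonneg hM0 hε.le, mul_nonneg hk0 (mul_nonneg hM0 hε.le)]

end Summit.CriticalPhenomena.CardyFormulaZ2.Cruxes.MagicFormulaT.LineSketch

end
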